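import Summits.BirchSwinnertonDyer.BirchSwinnertonDyer.Theorems.PrintCf2DisegniPairTwoLawRigidityClasses
import Summits.BirchSwinnertonDyer.BirchSwinnertonDyer.Theses.PrintCf2
import HarnessLib

/-!
# Road (C) `disegni-pair-two` — the route-A support item stmt-BirchSwinnertonDyer-28322 `PrintCf2.SplitBadTwoDescentLawSevenFreeOfFacts`
# (the (Δ1) descent law) from its EXISTENTIAL form: one datum per `7`-free member suffices

Cell `bsd-print-cf2`, width seat `bsd-line-cf2-p1-w8` (g30), `--supports stmt-BirchSwinnertonDyer-20368` (helper). THEOREMS ONLY (no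
`def`, no named fact introduced, no `sorry`); imports the route file directly and the rigidity theorems
(`PrintCf2DisegniPairTwoLawRigidityClasses.lean`, outside the cone). The item's `def` (route A rev 66, 2026-08-31) is the text of the
registered research stub (Δ1) `stub_law_descent_two` VERBATIM; `lawDescent_two_of_forall_exists` shows that text follows from its
existential form (the left-hand side is rigid: unit root, newform, periods, canonical minus-twist height are model/datum/generator-free).
So a prover of 28322 may establish the `2`-adic identity at ONE convenient datum per member (e.g. the frame's explicit partner model
`W_k = [1, −(3k+1), 0, −2d′², −d′³]`, its newform, its generator, THE canonical datum `cm7Twist_existsUnique_isCanonicalSqMinusTwist`) and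
conclude the item BY NAME. Nothing here proves 28322, (Δ1) or the crux 20368; BSD is not proved by any of this.

References: B. Mazur, J. Tate, J. Teitelbaum (1986) §I.14 [MazurTateTeitelbaum1986Invent]; B. Perrin-Riou (1987) Thm. 1.3 [PerrinRiou1987];
B. Mazur, W. Stein, J. Tate (2006) §1 [MazurSteinTate2006].
-/

set_option autoImplicit false
set_option linter.dupNamespace false

noncomputable section

open scoped Classical MatrixGroups ModularForm NumberField

open CongruenceSubgroup WeierstrassCurve Literature.NumberTheory.EllipticCurves
  Literature.NumberTheory.EllipticCurves.ModularForms

namespace Summit.BirchSwinnertonDyer.BirchSwinnertonDyer.Theorems.PrintCf2.DisegniPairTwo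

/-- ★ **The route-A support item stmt-BirchSwinnertonDyer-28322 `PrintCf2.SplitBadTwoDescentLawSevenFreeOfFacts` (= the (Δ1) text,
filed 2026-08-31 rev 66) from the EXISTENTIAL law**: one datum per `7`-free member suffices (`lawDescent_two_of_forall_exists`; the item's
`def` unfolds to the (Δ1) text verbatim). A prover of 28322 may therefore establish the identity at any convenient datum per member — e.g.
the frame's explicit partner model `W_k`, its newform and generator — and conclude the item BY NAME with this theorem. Nothing here proves
28322. [cite: MazurTateTeitelbaum1986Invent, §I.14] [cite: PerrinRiou1987, Thm. 1.3] -/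
theorem splitBadTwoDescentLawSevenFreeOfFacts_of_forall_exists
    (hex : ∃ e_D : ℤ → ℤ → ℤ,
      (∀ (d' : ℤ), d' % 4 = 1 → Squarefree d' → ¬ (7 : ℤ) ∣ d' →
        ∀ (W : WeierstrassCurve ℚ) [W.IsElliptic] [W.IsGloballyMinimal] (C₀ : VariableChange ℚ),
          C₀ • W = cm7.quadraticTwist (((2 * d' : ℤ)) : ℚ) → W.analyticRank = 1 →
        ∃ (V : WeierstrassCurve ℚ) (_ : V.IsElliptic) (_ : V.IsGloballyMinimal) (C₁ : VariableChange ℚ),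
          C₁ • V = cm7.quadraticTwist (d' : ℚ) ∧
        ∃ (N : ℕ) (_ : NeZero N) (f : CuspForm (Gamma0 N) 2), IsNewformOf V f ∧
        ∃ (ϖ : ℚ), ϖ ≠ 0 ∧ (ϖ : ℝ) * V.realPeriodRat = plusPeriod f ∧
        ∃ (_ : (V.quadraticTwist 2).IsElliptic) (C : VariableChange ℚ), C • W = V.quadraticTwist 2 ∧
        ∃ (P : (V.quadraticTwist 2).toAffine.Point), ¬ IsOfFinAddOrder P ∧
          (∀ R : (V.quadraticTwist 2).toAffine.Point,
            ∃ (k : ℤ) (T : (V.quadraticTwist 2).toAffine.Point), IsOfFinAddOrder T ∧ R = k • P + T) ∧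
        ∃ (Dc : PAdicHeightData (V.quadraticTwist 2) 2), Dc.IsCanonicalSqMinusTwist ∧
          (∑' k : ℕ, PowerSeries.coeff k (padicLFunction f (unitRoot V 2 : ℚ_[2])) * (k : ℚ_[2]) *
              (-2) ^ (k - 1)).valuation + padicValRat 2 ϖ - (Dc.pairing P P).valuation =
            (padicValNat 2 (Nat.card (AddCommGroup.primaryComponent W.sha 2)) : ℤ) +
              (padicValNat 2 W.tamagawaProduct : ℤ) - 2 * (padicValNat 2 W.torsionOrder : ℤ) + e_D 0 (d' % 8)) ∧
      (∀ (d' : ℤ), d' % 4 = 1 → Squarefree d' → ¬ (7 : ℤ) ∣ d' →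
        ∀ (W : WeierstrassCurve ℚ) [W.IsElliptic] [W.IsGloballyMinimal] (C₀ : VariableChange ℚ),
          C₀ • W = cm7.quadraticTwist (((-d' : ℤ)) : ℚ) → W.analyticRank = 1 →
        ∃ (V : WeierstrassCurve ℚ) (_ : V.IsElliptic) (_ : V.IsGloballyMinimal) (C₁ : VariableChange ℚ),
          C₁ • V = cm7.quadraticTwist (d' : ℚ) ∧
        ∃ (N : ℕ) (_ : NeZero N) (f : CuspForm (Gamma0 N) 2), IsNewformOf V f ∧
        ∃ (μ : ℚ), μ ≠ 0 ∧ (μ : ℝ) * V.imaginaryPeriodRat = minusPeriod f ∧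
        ∃ (_ : (V.quadraticTwist (-1)).IsElliptic) (C : VariableChange ℚ), C • W = V.quadraticTwist (-1) ∧
        ∃ (P : (V.quadraticTwist (-1)).toAffine.Point), ¬ IsOfFinAddOrder P ∧
          (∀ R : (V.quadraticTwist (-1)).toAffine.Point,
            ∃ (k : ℤ) (T : (V.quadraticTwist (-1)).toAffine.Point), IsOfFinAddOrder T ∧ R = k • P + T) ∧
        ∃ (Dc : PAdicHeightData (V.quadraticTwist (-1)) 2), Dc.IsCanonicalSqMinusTwist ∧
          (PowerSeries.coeff 1 (padicLFunctionMinusBranch f (unitRoot V 2 : ℚ_[2]) 1)).valuation + padicValRat 2 μ - (Dc.pairing P P).valuation =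
            (padicValNat 2 (Nat.card (AddCommGroup.primaryComponent W.sha 2)) : ℤ) +
              (padicValNat 2 W.tamagawaProduct : ℤ) - 2 * (padicValNat 2 W.torsionOrder : ℤ) + e_D 1 ((-d') % 8)) ∧
      (∀ (d' : ℤ), d' % 4 = 1 → Squarefree d' → ¬ (7 : ℤ) ∣ d' →
        ∀ (W : WeierstrassCurve ℚ) [W.IsElliptic] [W.IsGloballyMinimal] (C₀ : VariableChange ℚ),
          C₀ • W = cm7.quadraticTwist (((-2 * d' : ℤ)) : ℚ) → W.analyticRank = 1 →
        ∃ (V : WeierstrassCurve ℚ) (_ : V.IsElliptic) (_ : V.IsGloballyMinimal) (C₁ : VariableChange ℚ),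
          C₁ • V = cm7.quadraticTwist (d' : ℚ) ∧
        ∃ (N : ℕ) (_ : NeZero N) (f : CuspForm (Gamma0 N) 2), IsNewformOf V f ∧
        ∃ (μ : ℚ), μ ≠ 0 ∧ (μ : ℝ) * V.imaginaryPeriodRat = minusPeriod f ∧
        ∃ (_ : (V.quadraticTwist (-2)).IsElliptic) (C : VariableChange ℚ), C • W = V.quadraticTwist (-2) ∧
        ∃ (P : (V.quadraticTwist (-2)).toAffine.Point), ¬ IsOfFinAddOrder P ∧
          (∀ R : (V.quadraticTwist (-2)).toAffine.Point,
            ∃ (k : ℤ) (T : (V.quadraticTwist (-2)).toAffine.Point), IsOfFinAddOrder T ∧ R = k • P + T) ∧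
        ∃ (Dc : PAdicHeightData (V.quadraticTwist (-2)) 2), Dc.IsCanonicalSqMinusTwist ∧
          (∑' k : ℕ, PowerSeries.coeff k (padicLFunctionMinusBranch f (unitRoot V 2 : ℚ_[2]) 1) * (k : ℚ_[2]) *
              (-2) ^ (k - 1)).valuation + padicValRat 2 μ - (Dc.pairing P P).valuation =
            (padicValNat 2 (Nat.card (AddCommGroup.primaryComponent W.sha 2)) : ℤ) +
              (padicValNat 2 W.tamagawaProduct : ℤ) - 2 * (padicValNat 2 W.torsionOrder : ℤ) + e_D 0 ((-d') % 8))) :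
    Summit.BirchSwinnertonDyer.BirchSwinnertonDyer.Theses.PrintCf2.SplitBadTwoDescentLawSevenFreeOfFacts :=
  lawDescent_two_of_forall_exists hex

end Summit.BirchSwinnertonDyer.BirchSwinnertonDyer.Theorems.PrintCf2.DisegniPairTwo

end
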